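import Literature.Computability.QuantumComplexity.RestBlockStates
import Literature.Computability.QuantumComplexity.ApproxImplementation
import HarnessLib

/-!
# Classical maps on block states, Bennett's copy branches, and their Born weights

Second infrastructure file (after `RestBlockStates.lean`) for the analysis of a quantum
subroutine run on a block `E : Fin b ↪ Fin W` of a register whose other wires are classical,
followed by a classically controlled copy of the block into the rest and by the inverse of the
subroutine (Bennett's compute–copy–uncompute applied to a *quantum* computation:
Bennett–Bernstein–Brassard–Vazirani 1997, proof of Thm. 4.14; classical pre/post-processing
inside `BQP`, Bernstein–Vazirani 1997, §8; the principle of deferred measurement, Nielsen–Chuang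
2010, §4.4):

* `IsBasisMap M κ` — `M` permutes basis states along `κ` (compiled reversible classical
  circuits, `revCompile_mulVec_basisState`); such an `M` acts on a block state by acting on the
  classical rest when `κ` commutes with writing the block
  (`IsBasisMap.mulVec_restBlockState_of_comm`), and turns it into the **branch sum**
  `∑_f φ(f) |τ_f c⟩ ⊗ |f⟩` when `κ` copies the block into the rest
  (`IsBasisMap.mulVec_restBlockState_of_extend`; `branchSum`);
* supports (`SuppIn P v` of `ApproxImplementation.lean`, reused) and **`iteration_eq_self`**: "controlled classical map, `U` on the block, controlled copy,
  `V` on the block with `V U = 1`, controlled classical map" is the identity on every state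
  supported where the controls are off — the iterations of a multiplexed subroutine that are
  not selected do nothing;
* **Born weights of a branch sum** (`sum_mul_normSq_branchSum`): if the classical rests `c y`
  of distinct branches differ off the block, the branches are orthogonal and
  `∑_z g(z) |Σ_y a_y (|c_y⟩ ⊗ |φ_y⟩)(z)|² = ∑_y |a_y|² ∑_f g(c_y with block f) |φ_y(f)|²`; whence
  the lower bound `sum_ite_normSq_branchSum_ge` used to read a success probability off the
  copied register (deferred measurement).

## References

* C. H. Bennett, E. Bernstein, G. Brassard, U. Vazirani, *Strengths and weaknesses of quantum
  computing*, SIAM J. Comput. 26 (1997) 1510–1523, Thm. 4.14 (proof: run, copy the answer,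
  undo).
* E. Bernstein, U. Vazirani, *Quantum complexity theory*, SIAM J. Comput. 26 (1997), §8.
* M. A. Nielsen, I. L. Chuang, *Quantum Computation and Quantum Information*, CUP 2010,
  §2.1.7 eq. (2.45), §2.2.8, §3.2.5 (uncomputation), §4.4 (principle of deferred measurement).
-/

noncomputable section

open Matrix

namespace Literature.Computability.QuantumComplexity

open Cryptography

open scoped Classical

variable {b W : ℕ}

/-! ### Matrices permuting the basis states -/

/-- `IsBasisMap M κ`: the matrix `M` maps every basis state `|z⟩` to the basis state `|κ z⟩`
(e.g. a compiled reversible classical circuit, `revCompile_mulVec_basisState`).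
[Nielsen–Chuang 2010, §3.2.5] [cite: NielsenChuang2010, §3.2.5] -/
def IsBasisMap (M : Matrix (QReg W) (QReg W) ℂ) (κ : QReg W → QReg W) : Prop :=
  ∀ z, M *ᵥ basisState z = basisState (κ z)

section BasisMap

variable {M N : Matrix (QReg W) (QReg W) ℂ} {κ ν : QReg W → QReg W}

/-- A state is the superposition of its amplitudes (copy of
`ControlledHadamard.eq_sum_smul_basisState`, renamed to keep that file out of the imports). [folklore] -/
theorem state_eq_sum_smul_basisState (v : QReg W → ℂ) : v = ∑ z, v z • basisState z := by
  funext x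
  simp [Finset.sum_apply, basisState_apply]

/-- **A basis map acts amplitude-wise**: `M v = ∑_z v(z) |κ z⟩`. [folklore] -/
theorem IsBasisMap.mulVec_eq_sum (h : IsBasisMap M κ) (v : QReg W → ℂ) :
    M *ᵥ v = ∑ z, v z • basisState (κ z) := by
  conv_lhs => rw [state_eq_sum_smul_basisState v]
  rw [Matrix.mulVec_sum]
  simp_rw [Matrix.mulVec_smul, show ∀ z, M *ᵥ basisState z = basisState (κ z) from h]

/-- The identity matrix is a basis map along the identity. [folklore] -/
theorem isBasisMap_one : IsBasisMap (1 : Matrix (QReg W) (QReg W) ℂ) id := fun z => by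
  rw [Matrix.one_mulVec]; rfl

/-- Basis maps compose. [folklore] -/
theorem IsBasisMap.mul (hN : IsBasisMap N ν) (hM : IsBasisMap M κ) : IsBasisMap (N * M) (ν ∘ κ) :=
  fun z => by rw [← Matrix.mulVec_mulVec, hM, hN]; rfl

/-- A basis map fixing every basis state of the support fixes the state. [folklore] -/
theorem IsBasisMap.mulVec_eq_self (h : IsBasisMap M κ) {v : QReg W → ℂ}
    (hfix : ∀ z, v z ≠ 0 → κ z = z) : M *ᵥ v = v := by
  rw [h.mulVec_eq_sum]
  conv_rhs => rw [state_eq_sum_smul_basisState v]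
  refine Finset.sum_congr rfl fun z _ => ?_
  by_cases hz : v z = 0
  · simp [hz]
  · rw [hfix z hz]

/-- **A basis map commuting with writing the block acts on the classical rest** of a block
state: if `κ (c with block f) = (κ c) with block f`, then `M (|c⟩ ⊗ |φ⟩) = |κ c⟩ ⊗ |φ⟩`.
[Nielsen–Chuang 2010, §2.1.7] [folklore] -/
theorem IsBasisMap.mulVec_restBlockState_of_comm (E : Fin b ↪ Fin W) (h : IsBasisMap M κ)
    (hκ : ∀ (f : QReg b) (c : QReg W), κ (Function.extend E f c) = Function.extend E f (κ c))
    (φ : QReg b → ℂ) (c : QReg W) :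
    M *ᵥ restBlockState E φ c = restBlockState E φ (κ c) := by
  rw [restBlockState_eq_sum, Matrix.mulVec_sum]
  simp_rw [Matrix.mulVec_smul, show ∀ z, M *ᵥ basisState z = basisState (κ z) from h, hκ]
  rw [← restBlockState_eq_sum]

/-- **A basis map copying the block into the rest produces the branch superposition**: if
`κ (c with block f) = (τ_f c) with block f`, then `M (|c⟩ ⊗ |φ⟩) = ∑_f φ(f) |(τ_f c) with block f⟩`.
[Bennett–Bernstein–Brassard–Vazirani 1997, Thm. 4.14 (proof: copy the answer); Nielsen–Chuang
2010, §3.2.5] [cite: NielsenChuang2010, §3.2.5] -/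
theorem IsBasisMap.mulVec_restBlockState_of_extend (E : Fin b ↪ Fin W) (h : IsBasisMap M κ)
    (τ : QReg b → QReg W → QReg W)
    (hκ : ∀ (f : QReg b) (c : QReg W), κ (Function.extend E f c) = Function.extend E f (τ f c))
    (φ : QReg b → ℂ) (c : QReg W) :
    M *ᵥ restBlockState E φ c = ∑ f, φ f • basisState (Function.extend E f (τ f c)) := by
  rw [restBlockState_eq_sum, Matrix.mulVec_sum]
  simp_rw [Matrix.mulVec_smul, show ∀ z, M *ᵥ basisState z = basisState (κ z) from h, hκ]

end BasisMap

/-! ### Branch sums -/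

/-- **Branch sum**: `∑_y a(y) · (|c_y|_{off E}⟩ ⊗ |φ_y⟩_E)` — the state after a block state
`∑_y a(y)|y⟩` has been copied into the rest (`c_y`) and the block further transformed (`φ_y`).
[Bennett–Bernstein–Brassard–Vazirani 1997, Thm. 4.14 (proof)] [folklore] -/
def branchSum (E : Fin b ↪ Fin W) (a : QReg b → ℂ) (φ : QReg b → QReg b → ℂ) (c : QReg b → QReg W) :
    QReg W → ℂ :=
  ∑ y, a y • restBlockState E (φ y) (c y)

section Branch

variable (E : Fin b ↪ Fin W)

/-- Unfolding `branchSum`. [folklore] -/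
theorem branchSum_def (a : QReg b → ℂ) (φ : QReg b → QReg b → ℂ) (c : QReg b → QReg W) :
    branchSum E a φ c = ∑ y, a y • restBlockState E (φ y) (c y) := rfl

/-- Amplitudes of a branch sum. [folklore] -/
theorem branchSum_apply (a : QReg b → ℂ) (φ : QReg b → QReg b → ℂ) (c : QReg b → QReg W) (z : QReg W) :
    branchSum E a φ c z = ∑ y, a y * restBlockState E (φ y) (c y) z := by
  simp [branchSum, Finset.sum_apply]

/-- The superposition produced by a copy is the branch sum with basis blocks. [folklore] -/
theorem sum_smul_basisState_extend_eq_branchSum (a : QReg b → ℂ) (c : QReg b → QReg W) :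
    ∑ f, a f • basisState (Function.extend E f (c f)) = branchSum E a (fun f => basisState f) c := by
  simp_rw [branchSum, restBlockState_basisState]

/-- **An operator on the block acts branch-wise on the block factors.** [Nielsen–Chuang 2010,
§2.1.7] [cite: NielsenChuang2010, §2.1.7 eq. (2.45)] -/
theorem placeGate_mulVec_branchSum (V : Matrix (QReg b) (QReg b) ℂ) (a : QReg b → ℂ)
    (φ : QReg b → QReg b → ℂ) (c : QReg b → QReg W) :
    placeGate E V *ᵥ branchSum E a φ c = branchSum E a (fun y => V *ᵥ φ y) c := by
  rw [branchSum, Matrix.mulVec_sum, branchSum]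
  simp_rw [Matrix.mulVec_smul, placeGate_mulVec_restBlockState]

/-- **A basis map commuting with writing the block acts branch-wise on the classical rests.**
[folklore] -/
theorem IsBasisMap.mulVec_branchSum_of_comm {M : Matrix (QReg W) (QReg W) ℂ} {κ : QReg W → QReg W}
    (h : IsBasisMap M κ)
    (hκ : ∀ (f : QReg b) (c : QReg W), κ (Function.extend E f c) = Function.extend E f (κ c))
    (a : QReg b → ℂ) (φ : QReg b → QReg b → ℂ) (c : QReg b → QReg W) :
    M *ᵥ branchSum E a φ c = branchSum E a φ (κ ∘ c) := by
  rw [branchSum, Matrix.mulVec_sum, branchSum]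
  simp_rw [Matrix.mulVec_smul, h.mulVec_restBlockState_of_comm E hκ]
  rfl

end Branch

/-! ### Supports and the identity iterations -/

section Supp

variable {P : Set (QReg W)}

/-- A block state is supported on the registers agreeing with its rest off the block
(`SuppIn` of `ApproxImplementation.lean`: the amplitudes vanish off `P`). [folklore] -/
theorem suppIn_restBlockState (E : Fin b ↪ Fin W) {φ : QReg b → ℂ} {c : QReg W}
    (h : ∀ z, AgreeOff E z c → z ∈ P) : SuppIn P (restBlockState E φ c) := by
  intro z hz
  rw [restBlockState_apply, if_neg fun hzc => hz (h z hzc)]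

/-- A branch sum is supported on the registers agreeing with some rest off the block. [folklore] -/
theorem suppIn_branchSum (E : Fin b ↪ Fin W) {a : QReg b → ℂ} {φ : QReg b → QReg b → ℂ}
    {c : QReg b → QReg W} (h : ∀ y z, AgreeOff E z (c y) → z ∈ P) : SuppIn P (branchSum E a φ c) := by
  intro z hz
  rw [branchSum_apply]
  exact Finset.sum_eq_zero fun y _ => by rw [suppIn_restBlockState E (h y) z hz, mul_zero]

/-- **A basis map fixing the `P`-states fixes every state supported in `P`** (a classically
controlled operation whose controls are off). [Nielsen–Chuang 2010, §4.3] [folklore] -/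
theorem IsBasisMap.mulVec_eq_self_of_suppIn {M : Matrix (QReg W) (QReg W) ℂ} {κ : QReg W → QReg W}
    (h : IsBasisMap M κ) (hfix : ∀ z ∈ P, κ z = z) {v : QReg W → ℂ} (hv : SuppIn P v) :
    M *ᵥ v = v :=
  h.mulVec_eq_self fun z hz => hfix z (by_contra fun hP => hz (hv z hP))

/-- An operator on the block preserves supports described off the block. [folklore] -/
theorem SuppIn.placeGate_of_extend_mem (E : Fin b ↪ Fin W) {v : QReg W → ℂ} (hv : SuppIn P v)
    (hP : ∀ z ∈ P, ∀ f : QReg b, Function.extend E f z ∈ P) (U : Matrix (QReg b) (QReg b) ℂ) :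
    SuppIn P (placeGate E U *ᵥ v) := by
  intro x hx
  rw [placeGate_mulVec_apply]
  refine Finset.sum_eq_zero fun f _ => ?_
  have hf : Function.extend E f x ∉ P := fun h => hx <| by
    have h' := hP _ h (x ∘ E)
    rwa [extend_extend, extend_restrict_self] at h'
  rw [hv _ hf, mul_zero]

/-- **The non-selected iterations do nothing.** Let `M₁, M₂, M₃` be basis maps fixing every
`P`-state (classical gadgets whose controls are off on `P`), `P` a property of the wires off
the block, and `V U = 1`. Then `M₃ · V_E · M₂ · U_E · M₁` is the identity on every state
supported in `P` — the quantum subroutine is run and exactly undone.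
[Bennett–Bernstein–Brassard–Vazirani 1997, Thm. 4.14 (proof); Nielsen–Chuang 2010, §3.2.5]
[cite: NielsenChuang2010, §3.2.5] -/
theorem iteration_eq_self (E : Fin b ↪ Fin W) {M₁ M₂ M₃ : Matrix (QReg W) (QReg W) ℂ}
    {κ₁ κ₂ κ₃ : QReg W → QReg W} (h₁ : IsBasisMap M₁ κ₁) (h₂ : IsBasisMap M₂ κ₂) (h₃ : IsBasisMap M₃ κ₃)
    (hfix₁ : ∀ z ∈ P, κ₁ z = z) (hfix₂ : ∀ z ∈ P, κ₂ z = z) (hfix₃ : ∀ z ∈ P, κ₃ z = z)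
    (hP : ∀ z ∈ P, ∀ f : QReg b, Function.extend E f z ∈ P)
    {U V : Matrix (QReg b) (QReg b) ℂ} (hVU : V * U = 1) {v : QReg W → ℂ} (hv : SuppIn P v) :
    M₃ *ᵥ (placeGate E V *ᵥ (M₂ *ᵥ (placeGate E U *ᵥ (M₁ *ᵥ v)))) = v := by
  rw [h₁.mulVec_eq_self_of_suppIn hfix₁ hv,
    h₂.mulVec_eq_self_of_suppIn hfix₂ (hv.placeGate_of_extend_mem E hP U),
    Matrix.mulVec_mulVec v (placeGate E V) (placeGate E U), ← placeGate_mul_holds, hVU, placeGate_one,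
    Matrix.one_mulVec, h₃.mulVec_eq_self_of_suppIn hfix₃ hv]

end Supp

/-! ### Born weights of a branch sum -/

section Born

variable (E : Fin b ↪ Fin W)

/-- In a branch sum whose rests are pairwise distinguishable off the block, at most one branch
contributes to each amplitude. [folklore] -/
theorem restBlockState_apply_eq_zero_of_ne {c : QReg b → QReg W}
    (hinj : ∀ y y', AgreeOff E (c y) (c y') → y = y') {z : QReg W} {y₀ y : QReg b}
    (h₀ : AgreeOff E z (c y₀)) (hy : y ≠ y₀) (φ : QReg b → ℂ) : restBlockState E φ (c y) z = 0 := by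
  rw [restBlockState_apply, if_neg]
  intro hz
  exact hy (hinj y y₀ ((hz.symm E).trans E h₀))

/-- **Squared amplitude of a branch sum with distinguishable rests**: the cross terms vanish,
`|Σ_y a_y (|c_y⟩⊗|φ_y⟩)(z)|² = Σ_y |a_y|² · [z ≡ c_y off E] · |φ_y(z|_E)|²`. [folklore] -/
theorem normSq_branchSum_apply (a : QReg b → ℂ) (φ : QReg b → QReg b → ℂ) {c : QReg b → QReg W}
    (hinj : ∀ y y', AgreeOff E (c y) (c y') → y = y') (z : QReg W) :
    ‖branchSum E a φ c z‖ ^ 2 = ∑ y, ‖a y‖ ^ 2 * ‖restBlockState E (φ y) (c y) z‖ ^ 2 := by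
  rw [branchSum_apply]
  by_cases h : ∃ y₀, AgreeOff E z (c y₀)
  · obtain ⟨y₀, h₀⟩ := h
    rw [Finset.sum_eq_single y₀, Finset.sum_eq_single y₀, norm_mul, mul_pow]
    · intro y _ hy; rw [restBlockState_apply_eq_zero_of_ne E hinj h₀ hy]; simp
    · intro h; exact absurd (Finset.mem_univ _) h
    · intro y _ hy; rw [restBlockState_apply_eq_zero_of_ne E hinj h₀ hy, mul_zero]
    · intro h; exact absurd (Finset.mem_univ _) h
  · push Not at h
    have h0 : ∀ y, restBlockState E (φ y) (c y) z = 0 := fun y => by rw [restBlockState_apply, if_neg (h y)]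
    simp [h0]

/-- **Born weights of a branch sum** (the branches are orthogonal): for every weight `g`,
`∑_z g(z) |Σ_y a_y (|c_y⟩⊗|φ_y⟩)(z)|² = ∑_y |a_y|² ∑_f g(c_y with block f) |φ_y(f)|²`.
[Nielsen–Chuang 2010, §2.2.8, §4.4 (deferred measurement)] [cite: NielsenChuang2010, §4.4] -/
theorem sum_mul_normSq_branchSum (a : QReg b → ℂ) (φ : QReg b → QReg b → ℂ) {c : QReg b → QReg W}
    (hinj : ∀ y y', AgreeOff E (c y) (c y') → y = y') (g : QReg W → ℝ) :
    ∑ z, g z * ‖branchSum E a φ c z‖ ^ 2 =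
      ∑ y, ‖a y‖ ^ 2 * ∑ f, g (Function.extend E f (c y)) * ‖φ y f‖ ^ 2 := by
  simp_rw [normSq_branchSum_apply E a φ hinj, Finset.mul_sum]
  rw [Finset.sum_comm]
  refine Finset.sum_congr rfl fun y _ => ?_
  have h : ∀ z, g z * (‖a y‖ ^ 2 * ‖restBlockState E (φ y) (c y) z‖ ^ 2) =
      if AgreeOff E z (c y) then ‖a y‖ ^ 2 * (g z * ‖φ y (z ∘ E)‖ ^ 2) else 0 := by
    intro z
    rw [restBlockState_apply]
    split_ifs
    · ring
    · simp
  simp_rw [h]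
  rw [sum_ite_agreeOff_eq_sum_extend E (c y)]
  simp_rw [extend_comp_embedding]

/-- **Reading a success probability off the copied register** (deferred measurement). If the
rests distinguish the branches, the block factors are unit vectors, and every register of a
*good* branch lies in the target event `T` whatever its block content, then the Born weight of
`T` is at least the total weight `∑_{y good} |a_y|²` of the good branches.
[Nielsen–Chuang 2010, §4.4; Bennett–Bernstein–Brassard–Vazirani 1997, Thm. 4.14 (proof)]
[cite: NielsenChuang2010, §4.4] -/
theorem sum_ite_normSq_branchSum_ge (a : QReg b → ℂ) (φ : QReg b → QReg b → ℂ) {c : QReg b → QReg W}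
    (hinj : ∀ y y', AgreeOff E (c y) (c y') → y = y') (hφ : ∀ y, ∑ f, ‖φ y f‖ ^ 2 = 1)
    (T : QReg W → Prop) [DecidablePred T] (Good : QReg b → Prop) [DecidablePred Good]
    (hgood : ∀ y, Good y → ∀ f, T (Function.extend E f (c y))) :
    (∑ y, if Good y then ‖a y‖ ^ 2 else 0) ≤ ∑ z, if T z then ‖branchSum E a φ c z‖ ^ 2 else 0 := by
  have hrw : (∑ z, if T z then ‖branchSum E a φ c z‖ ^ 2 else 0) =
      ∑ z, (if T z then (1 : ℝ) else 0) * ‖branchSum E a φ c z‖ ^ 2 :=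
    Finset.sum_congr rfl fun z _ => by split_ifs <;> simp
  rw [hrw, sum_mul_normSq_branchSum E a φ hinj]
  refine Finset.sum_le_sum fun y _ => ?_
  by_cases hy : Good y
  · rw [if_pos hy]
    have h1 : ∑ f, (if T (Function.extend E f (c y)) then (1 : ℝ) else 0) * ‖φ y f‖ ^ 2 =
        ∑ f, ‖φ y f‖ ^ 2 :=
      Finset.sum_congr rfl fun f _ => by rw [if_pos (hgood y hy f), one_mul]
    rw [h1, hφ y, mul_one]
  · rw [if_neg hy]
    exact mul_nonneg (sq_nonneg _) (Finset.sum_nonneg fun f _ => mul_nonneg (by split_ifs <;> norm_num) (sq_nonneg _))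

end Born

end Literature.Computability.QuantumComplexity
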